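import Summits.QuantumFields.YangMills.Theorems.UnitScaleTiltProp7TwoBackgroundGradientComparison
import Summits.QuantumFields.YangMills.Theorems.UnitScaleTiltProp7FlatMemberLocalGradientSourced
import Literature.MathematicalPhysics.QuantumFieldTheory.Balaban1983to89.B9Eq340HolderRowOfGradientRow
import HarnessLib

/-!
# Route `UnitScaleTilt`, crux K1 «MinimiserStabilityRegPr» (stmt-QuantumFields-19200), EX face after S45 — (L3′b)-GRAD FILE **(G1-3a): THE LOCAL KNIT AT ONE BALL IN A GIVEN
# GAUGE** — the curved η-gradient row `ℓ‖u(x+e_μ) − u(x)‖ ≤ Cg·(M₀ + a·G)` at the centre of a `tdist`-ball where the background `V` is `δ`-close to `1` with ½-Hölder modulus `Θ`,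
# from ✓`two_background_gradient_comparison` (G1-2) ⊕ w5 g14's SOURCED flat member lemma ✓`exists_localGradient_flat_member_sourced` (G1-0′; ✓p763087) ⊕ the
# lattice-path modulus (lit ✓`B9Eq340HolderRowOfGradientRow.norm_sub_le_of_step_bound`: `H_u ≤ 3√10·G`) — ★p1 g25 CHAIR WORDS №6∕№7 (2026-08-30 05:38Z∕05:44Z): «(G1-3) KNIT → px12».

Cell `ym3-torus` (HUMAN RULING D-0037; rung R3 = SU(2) YM₃ on T³ — NOT d = 4, NOT infinite volume, NOT a mass gap, NOT Clay).  Width seat `ym3-torus-px12` (gen 15).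
THEOREMS ONLY (0 `def`, 0 `sorry`, default heartbeats); `--supports stmt-QuantumFields-19200 --as helper`; count-neutral.

WHY.  (G1-3) = the curved member gradient row (the chair's V6 letter `hDcol`).  Stage (a), THIS FILE: at ONE ball `B(x, 4ℓ)` in ONE gauge, compose (G1-2)'s flat equation
`(Δ^η_1 + 1)u = D*_1 g + r` (`g := f − (D_V − D_1)u`, `r := (D*_V − D*_1)(f − D_V u) + (u − q)`) and its `M_g`∕`H_g`∕`M_r` rows with the sourced flat lemma, feeding the ½-Hölder letter
`H_u` from the η-gradient sup letter `G` by the lattice path bound (`‖u(y′) − u(y)‖ ≤ 3·tdist·(G∕ℓ) ≤ 3√10·G·(tdist∕ℓ)^{½}` on `tdist ≤ 10ℓ`).  OUTPUT: `ℓ‖u(x+e_μ) − u(x)‖ ≤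
Cg·(M_u + H_f + 2√2((ℓΘ)M_u + (ℓδ)·3√10·G) + 6√2(ℓδ)(M_f + G + 2√2(ℓδ)M_u) + M_u + M_q)` — `G` STILL DISPLAYED (honest: the flat lemma's ball = its mass scale, so the
absorption closes only GLOBALLY — stage (b), the weighted sup over the torus of the gauge-invariant `‖(D_{U₀}u)(b)‖`, then ✓`gradient_absorption`).

WHAT IS PROVED (ns `Summit.QuantumFields.YangMills.Theorems.Prop7CurvedMemberLocalGradient`).
* §1 `div_le_sqrt_mul_rpow_half` (`q ≤ √s₀·q^{½}` for `0 ≤ q ≤ s₀`) · ★`holder_of_eta_gradient` — `H_u := 3√10·G` on the `(4ℓ+1)`-ball from the η-gradient sup `G` on the `(12ℓ+3)`-ball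
  (lit ✓`norm_sub_le_of_step_bound` + triangle bookkeeping).
* §2 ★★`curved_localGradient_of_flatSourced` — the knit at given `(F, n, K, c₀)`, with the sourced flat lemma as the displayed hypothesis `hD` (its ∀-form at the given `u`, `x`: for all
  data `g r` and letters `Mu′ Hf′ Mr′`) · ★★★`exists_curved_localGradient` — `hD` DISCHARGED BY NAME by ✓`exists_localGradient_flat_member_sourced`: ONE `Cg ≥ 0` for all members
  `(F, n, K)`, weights `c₀`, backgrounds `V`, data `u q f` and centres `x` (`∃ Cg, 0 ≤ Cg ∧ ∀ …`, the flat lemma's `K`-free constant).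
HYP-SAT (★★OWNER RULING №42).  Every hypothesis is an equation or a real inequality between displayed terms: `h` is the member equation itself (for the LOD column
`u = G(T(ι(δ_y ⊗ Y)))` of V5∕V6 it holds with `f := 0`, `q := a•T(ι(Q″u)) − T(ι(δ_y ⊗ Y))` by V6's `hAG`); the seven rows `hMu hG hMf hHf hMq hδ hΘ` are inhabited at any fixed
data by the finite maxima over the (finite) balls (`Θ`, `H_f` with the ½-power ≥ `ℓ^{−1∕2}·1` off the diagonal), and — the point — with `K`-FREE letters on the literal T³ member:
`ℓδ = 2ε₀(R′+1)`-class by ✓`Prop7CubeCutoffFlatness.hUV_cubeGauge` in the cube axial gauge, `ℓΘ = O(ε₀)` by ✓`AxialGaugeMemberModulus.dist1_axialT_translate_le_of_clauses` (px19),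
`M_u`, `M_q` by V4∕V5's column decay.  The conclusion is a non-vacuous real inequality; no `Prop`-valued hypothesis restates it.
HONEST SCOPE.  Composition; `δ`, `Θ`, `G`, `M_u`, `M_f`, `H_f`, `M_q` are letters; nothing of (G1-3b) (the weighted global absorption), V6's `hDcol`, the ten print rows, `hT`, `hGF`,
EX `stub_existenceMinimalOrbit` or the crux is proved here; the Yang–Mills mass gap is NOT proved.

References: T. Bałaban, CMP **99** (1985) 389–434 [Balaban1985BackgroundPropagators] (Thm 3.1 (3.43)–(3.44) p.398, (3.3) p.391, (3.8) p.392, (3.40) p.397);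
CMP **96** (1984) 223–250 [Balaban1984PropagatorsII] ((1.9) p.226).
-/

set_option autoImplicit false

noncomputable section

open scoped InnerProductSpace ComplexConjugate BigOperators Matrix.Norms.L2Operator

namespace Summit.QuantumFields.YangMills.Theorems.Prop7CurvedMemberLocalGradient

open Literature.MathematicalPhysics.QuantumFieldTheory.Balaban1983to89
open Literature.MathematicalPhysics.QuantumFieldTheory.Balaban1983to89.T3ContinuumYM3Torus
open B4Sect5Torus (TSite tdist tdist_triangle tdist_symm tdist_nonneg)
open B9SectCLatticeCarrier (Bond shift unshift)
open B9Eq311L2Pairing (WL2)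
open B11Eq103H1Complex (SiteL2K BondL2K)
open B9Eq340HolderRowOfGradientRow (norm_sub_le_of_step_bound)
open Summit.QuantumFields.YangMills.Theorems.Prop7SectET3Transport (periodsT3 bgOfCfg)
open Summit.QuantumFields.YangMills.Theorems.Prop7SectET3HilbertLetters (W₂ DL2 DstarL2 covLapSite)
open Summit.QuantumFields.YangMills.Theorems.Prop7TwoBackgroundGradientComparison (one_le_periodsT3 two_background_gradient_comparison)
open Summit.QuantumFields.YangMills.Theorems.Prop7FlatMemberLocalGradientSourced (exists_localGradient_flat_member_sourced)

/-! ## §1 The ½-Hölder letter of `u` from its η-gradient sup -/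

/-- `q ≤ √s₀·q^{½}` for `0 ≤ q ≤ s₀`. [folklore] -/
theorem div_le_sqrt_mul_rpow_half {q s₀ : ℝ} (hq : 0 ≤ q) (hqs : q ≤ s₀) : q ≤ Real.sqrt s₀ * q ^ ((1 : ℝ) / 2) := by
  rw [show q ^ ((1 : ℝ) / 2) = Real.sqrt q by rw [Real.sqrt_eq_rpow]]
  calc q = Real.sqrt q * Real.sqrt q := (Real.mul_self_sqrt hq).symm
    _ ≤ Real.sqrt s₀ * Real.sqrt q := mul_le_mul_of_nonneg_right (Real.sqrt_le_sqrt hqs) (Real.sqrt_nonneg _)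

variable (F : T3Family) (n K : ℕ) (c₀ : ℝ) [Fact (0 < c₀)]

omit [Fact (0 < c₀)] in
/-- ★ **`H_u` FROM `G`**: if `ℓ·‖u(z+e_μ) − u(z)‖ ≤ G` for every `z` in the `tdist`-ball `B(x, 12ℓ+3)` (`ℓ = L^{K−n}`), then for all `y, y′ ∈ B(x, 4ℓ+1)`:
`‖u(y′) − u(y)‖ ≤ (3√10·G)·(tdist(y,y′)∕ℓ)^{½}` — the lattice path bound (lit ✓`norm_sub_le_of_step_bound`: `≤ 3·tdist·(G∕ℓ)`, every step inside `B(y, tdist(y,y′)) ⊆ B(x, 12ℓ+3)`) and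
`tdist∕ℓ ≤ √10·(tdist∕ℓ)^{½}` on `tdist ≤ 8ℓ + 2 ≤ 10ℓ`. [cite: Balaban1985BackgroundPropagators, (3.40) p.397, Thm 3.1 (3.43) p.398] -/
theorem holder_of_eta_gradient (u : SiteL2K ℂ 3 (periodsT3 F K) c₀ W₂) (x : TSite 3 (periodsT3 F K)) {G : ℝ} (hG0 : 0 ≤ G)
    (hG : ∀ (z : TSite 3 (periodsT3 F K)) (μ : Fin 3), tdist (periodsT3 F K) x z ≤ 12 * (F.L : ℝ) ^ (K - n) + 3 →
      (F.L : ℝ) ^ (K - n) * ‖WL2.equiv ℂ (fun _ : TSite 3 (periodsT3 F K) => c₀) W₂ u (shift μ z) - WL2.equiv ℂ (fun _ : TSite 3 (periodsT3 F K) => c₀) W₂ u z‖ ≤ G) :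
    ∀ y y' : TSite 3 (periodsT3 F K), tdist (periodsT3 F K) x y ≤ 4 * (F.L : ℝ) ^ (K - n) + 1 → tdist (periodsT3 F K) x y' ≤ 4 * (F.L : ℝ) ^ (K - n) + 1 →
      ‖WL2.equiv ℂ (fun _ : TSite 3 (periodsT3 F K) => c₀) W₂ u y' - WL2.equiv ℂ (fun _ : TSite 3 (periodsT3 F K) => c₀) W₂ u y‖
        ≤ (3 * Real.sqrt 10 * G) * (tdist (periodsT3 F K) y y' / ((F.L : ℝ) ^ (K - n))) ^ ((1 : ℝ) / 2) := by
  intro y y' hy hy'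
  have hP := one_le_periodsT3 F K
  have hℓ1 : (1 : ℝ) ≤ (F.L : ℝ) ^ (K - n) := one_le_pow₀ (by have := F.hL.2; exact_mod_cast (by omega : 1 ≤ F.L))
  have hℓ0 : (0 : ℝ) < (F.L : ℝ) ^ (K - n) := by linarith
  set φ : TSite 3 (periodsT3 F K) → W₂ := fun z => WL2.equiv ℂ (fun _ : TSite 3 (periodsT3 F K) => c₀) W₂ u z with hφ
  have hyy' : tdist (periodsT3 F K) y y' ≤ 8 * (F.L : ℝ) ^ (K - n) + 2 := by
    have := tdist_triangle hP y x y'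
    rw [tdist_symm hP y x] at this
    linarith
  have hstep : ∀ (p : TSite 3 (periodsT3 F K)) (μ : Fin 3), tdist (periodsT3 F K) p y ≤ tdist (periodsT3 F K) y y' →
      tdist (periodsT3 F K) (shift μ p) y ≤ tdist (periodsT3 F K) y y' → ‖φ (shift μ p) - φ p‖ ≤ G / (F.L : ℝ) ^ (K - n) := by
    intro p μ hp _
    rw [le_div_iff₀ hℓ0, mul_comm]
    refine hG p μ ?_
    have := tdist_triangle hP x y p
    rw [tdist_symm hP p y] at hp
    linarith
  have h := norm_sub_le_of_step_bound hP φ y y' (div_nonneg hG0 hℓ0.le) hstep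
  have hq : 0 ≤ tdist (periodsT3 F K) y y' / (F.L : ℝ) ^ (K - n) := div_nonneg (tdist_nonneg _ _ _) hℓ0.le
  have hqs : tdist (periodsT3 F K) y y' / (F.L : ℝ) ^ (K - n) ≤ 10 := by
    rw [div_le_iff₀ hℓ0]; linarith
  have hkey := div_le_sqrt_mul_rpow_half hq hqs
  calc ‖φ y' - φ y‖ ≤ (3 : ℕ) * tdist (periodsT3 F K) y y' * (G / (F.L : ℝ) ^ (K - n)) := h
    _ = 3 * G * (tdist (periodsT3 F K) y y' / (F.L : ℝ) ^ (K - n)) := by push_cast; ring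
    _ ≤ 3 * G * (Real.sqrt 10 * (tdist (periodsT3 F K) y y' / (F.L : ℝ) ^ (K - n)) ^ ((1 : ℝ) / 2)) := mul_le_mul_of_nonneg_left hkey (by positivity)
    _ = (3 * Real.sqrt 10 * G) * (tdist (periodsT3 F K) y y' / ((F.L : ℝ) ^ (K - n))) ^ ((1 : ℝ) / 2) := by ring

/-! ## §2 ★★★ The local knit -/

/-- ★★★ **THE CURVED η-GRADIENT ROW AT THE CENTRE OF ONE BALL, IN A GIVEN GAUGE** ([Balaban1985BackgroundPropagators] Thm 3.1 (3.44) at a curved background, local form).  Member `F n K`,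
weight `c₀`, background `V`, centre `x`, `ℓ = L^{K−n}`; INPUT letters (all `≥ 0`): `M_u` (sup of `u` on `B(x, 4ℓ+1)`), `G` (η-gradient sup `ℓ‖u(z+e_μ) − u(z)‖ ≤ G` on `B(x, 12ℓ+3)`),
`M_f`, `H_f` (datum), `M_q` (penalty∕source, pointwise), `δ` (`‖V(b) − 1‖ ≤ δ` on `B(x, 4ℓ+1)`), `Θ` ((★): `‖V(y′,μ) − V(y,μ)‖ ≤ Θ·(tdist∕ℓ)^{½}` on `B(x, 4ℓ)`), the covariant equation
`Δ^η_V u + q = D*_V f`, and THE SOURCED FLAT LEMMA at `(u, x)` as the hypothesis `hD` (w5 g14's (G1-0′) `exists_localGradient_flat_member_sourced`, ∀ data `g r`, letters `Mu′ Hf′ Mr′`).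
OUTPUT: `ℓ‖u(x+e_μ) − u(x)‖ ≤ Cg·(M_u + (H_f + 2√2((ℓΘ)M_u + (ℓδ)(3√10·G))) + (6√2(ℓδ)(M_f + G + 2√2(ℓδ)M_u) + M_u + M_q))` — at the cube gauge `ℓδ`, `ℓΘ` are `O(ε₀)` K-FREE, so this is
`Cg·(M₀ + a·G)` with `a = (6√20 + 6√2)·ℓδ`. [cite: Balaban1985BackgroundPropagators, Thm 3.1 (3.43)–(3.44) p.398; Balaban1984PropagatorsII, (1.9) p.226] -/
theorem curved_localGradient_of_flatSourced (V : GaugeField (F.P K) 0 (Matrix.specialUnitaryGroup (Fin 2) ℂ))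
    (u q : SiteL2K ℂ 3 (periodsT3 F K) c₀ W₂) (f : BondL2K ℂ 3 (periodsT3 F K) c₀ W₂) (x : TSite 3 (periodsT3 F K))
    {Cg Mu G Mf Hf Mq δ Θ : ℝ} (hMu0 : 0 ≤ Mu) (hG0 : 0 ≤ G) (hMf0 : 0 ≤ Mf) (hHf0 : 0 ≤ Hf) (hMq0 : 0 ≤ Mq) (hδ0 : 0 ≤ δ) (hΘ0 : 0 ≤ Θ)
    (hD : ∀ (g : BondL2K ℂ 3 (periodsT3 F K) c₀ W₂) (r : SiteL2K ℂ 3 (periodsT3 F K) c₀ W₂) (Mu' Hf' Mr' : ℝ), 0 ≤ Mu' → 0 ≤ Hf' → 0 ≤ Mr' →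
      covLapSite F n K c₀ 1 u + ((1 : ℝ) : ℂ) • u = DstarL2 F n K c₀ 1 g + r →
      (∀ y, tdist (periodsT3 F K) x y ≤ 4 * ((F.L : ℝ) ^ (K - n)) → ‖WL2.equiv ℂ (fun _ : TSite 3 (periodsT3 F K) => c₀) W₂ u y‖ ≤ Mu') →
      (∀ (y y' : TSite 3 (periodsT3 F K)) (μ : Fin 3), tdist (periodsT3 F K) x y ≤ 4 * ((F.L : ℝ) ^ (K - n)) → tdist (periodsT3 F K) x y' ≤ 4 * ((F.L : ℝ) ^ (K - n)) →
        ‖WL2.equiv ℂ (fun _ : Bond 3 (periodsT3 F K) => c₀) W₂ g (y', μ) - WL2.equiv ℂ (fun _ : Bond 3 (periodsT3 F K) => c₀) W₂ g (y, μ)‖ ≤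
          Hf' * (tdist (periodsT3 F K) y y' / ((F.L : ℝ) ^ (K - n))) ^ ((1 : ℝ) / 2)) →
      (∀ y, tdist (periodsT3 F K) x y ≤ 4 * ((F.L : ℝ) ^ (K - n)) → ‖WL2.equiv ℂ (fun _ : TSite 3 (periodsT3 F K) => c₀) W₂ r y‖ ≤ Mr') →
      ∀ μ : Fin 3, (F.L : ℝ) ^ (K - n) * ‖WL2.equiv ℂ (fun _ : TSite 3 (periodsT3 F K) => c₀) W₂ u (shift μ x) - WL2.equiv ℂ (fun _ : TSite 3 (periodsT3 F K) => c₀) W₂ u x‖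
        ≤ Cg * (Mu' + Hf' + Mr'))
    (h : covLapSite F n K c₀ V u + q = DstarL2 F n K c₀ V f)
    (hMu : ∀ y, tdist (periodsT3 F K) x y ≤ 4 * (F.L : ℝ) ^ (K - n) + 1 → ‖WL2.equiv ℂ (fun _ : TSite 3 (periodsT3 F K) => c₀) W₂ u y‖ ≤ Mu)
    (hG : ∀ (z : TSite 3 (periodsT3 F K)) (μ : Fin 3), tdist (periodsT3 F K) x z ≤ 12 * (F.L : ℝ) ^ (K - n) + 3 →
      (F.L : ℝ) ^ (K - n) * ‖WL2.equiv ℂ (fun _ : TSite 3 (periodsT3 F K) => c₀) W₂ u (shift μ z) - WL2.equiv ℂ (fun _ : TSite 3 (periodsT3 F K) => c₀) W₂ u z‖ ≤ G)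
    (hMf : ∀ (y : TSite 3 (periodsT3 F K)) (μ : Fin 3), tdist (periodsT3 F K) x y ≤ 4 * (F.L : ℝ) ^ (K - n) + 1 →
      ‖WL2.equiv ℂ (fun _ : Bond 3 (periodsT3 F K) => c₀) W₂ f (y, μ)‖ ≤ Mf)
    (hHf : ∀ (y y' : TSite 3 (periodsT3 F K)) (μ : Fin 3), tdist (periodsT3 F K) x y ≤ 4 * (F.L : ℝ) ^ (K - n) → tdist (periodsT3 F K) x y' ≤ 4 * (F.L : ℝ) ^ (K - n) →
      ‖WL2.equiv ℂ (fun _ : Bond 3 (periodsT3 F K) => c₀) W₂ f (y', μ) - WL2.equiv ℂ (fun _ : Bond 3 (periodsT3 F K) => c₀) W₂ f (y, μ)‖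
        ≤ Hf * (tdist (periodsT3 F K) y y' / ((F.L : ℝ) ^ (K - n))) ^ ((1 : ℝ) / 2))
    (hMq : ∀ y, tdist (periodsT3 F K) x y ≤ 4 * (F.L : ℝ) ^ (K - n) → ‖WL2.equiv ℂ (fun _ : TSite 3 (periodsT3 F K) => c₀) W₂ q y‖ ≤ Mq)
    (hδ : ∀ (y : TSite 3 (periodsT3 F K)) (μ : Fin 3), tdist (periodsT3 F K) x y ≤ 4 * (F.L : ℝ) ^ (K - n) + 1 →
      ‖((bgOfCfg F K V (y, μ) : (Matrix (Fin 2) (Fin 2) ℂ)ˣ) : Matrix (Fin 2) (Fin 2) ℂ) - 1‖ ≤ δ)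
    (hΘ : ∀ (y y' : TSite 3 (periodsT3 F K)) (μ : Fin 3), tdist (periodsT3 F K) x y ≤ 4 * (F.L : ℝ) ^ (K - n) → tdist (periodsT3 F K) x y' ≤ 4 * (F.L : ℝ) ^ (K - n) →
      ‖((bgOfCfg F K V (y', μ) : (Matrix (Fin 2) (Fin 2) ℂ)ˣ) : Matrix (Fin 2) (Fin 2) ℂ) - ((bgOfCfg F K V (y, μ) : (Matrix (Fin 2) (Fin 2) ℂ)ˣ) : Matrix (Fin 2) (Fin 2) ℂ)‖
        ≤ Θ * (tdist (periodsT3 F K) y y' / ((F.L : ℝ) ^ (K - n))) ^ ((1 : ℝ) / 2)) :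
    ∀ μ : Fin 3, (F.L : ℝ) ^ (K - n) * ‖WL2.equiv ℂ (fun _ : TSite 3 (periodsT3 F K) => c₀) W₂ u (shift μ x) - WL2.equiv ℂ (fun _ : TSite 3 (periodsT3 F K) => c₀) W₂ u x‖
      ≤ Cg * (Mu + (Hf + 2 * Real.sqrt 2 * (((F.L : ℝ) ^ (K - n) * Θ) * Mu + ((F.L : ℝ) ^ (K - n) * δ) * (3 * Real.sqrt 10 * G)))
        + (6 * Real.sqrt 2 * ((F.L : ℝ) ^ (K - n) * δ) * (Mf + G + 2 * Real.sqrt 2 * ((F.L : ℝ) ^ (K - n) * δ) * Mu) + Mu + Mq)) := by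
  have hℓ0 : (0 : ℝ) ≤ (F.L : ℝ) ^ (K - n) := by positivity
  -- `H_u` from `G`
  have hHu := holder_of_eta_gradient F n K c₀ u x hG0 hG
  -- (G1-2) at `ρ := 4ℓ`
  obtain ⟨hflat, -, hHg, hMr⟩ := two_background_gradient_comparison n V u q f x (4 * (F.L : ℝ) ^ (K - n)) hδ0 hΘ0 h hMu
    (fun z μ hz => hG z μ (by linarith)) hHu hMf hHf hMq hδ hΘ
  -- the sourced flat lemma at the composite letters
  refine hD _ _ Mu (Hf + 2 * Real.sqrt 2 * (((F.L : ℝ) ^ (K - n) * Θ) * Mu + ((F.L : ℝ) ^ (K - n) * δ) * (3 * Real.sqrt 10 * G)))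
    (6 * Real.sqrt 2 * ((F.L : ℝ) ^ (K - n) * δ) * (Mf + G + 2 * Real.sqrt 2 * ((F.L : ℝ) ^ (K - n) * δ) * Mu) + Mu + Mq)
    hMu0 (by positivity) (by positivity) hflat (fun y hy => hMu y (by linarith)) hHg hMr

/-- ★★★ **THE CURVED MEMBER'S LOCAL GRADIENT ESTIMATE, `K`-FREE CONSTANT** ((G1-3a) proper): `curved_localGradient_of_flatSourced` with its displayed flat letter `hD`
DISCHARGED BY NAME by w5 g14's sourced flat member lemma ✓`Prop7FlatMemberLocalGradientSourced.exists_localGradient_flat_member_sourced` (superposition: Dirichlet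
replacement + discrete maximum principle + the flat interior gradient estimate).  ONE constant `Cg ≥ 0` for ALL members `(F, n, K)`, all unit weights `c₀`, all
backgrounds `V`, all balls: if `Δ_V u + q = D*_V f` on the torus, then at every centre `x`
`ℓ·‖u(x + e_μ) − u(x)‖ ≤ Cg·(M_u + (H_f + 2√2(ℓΘ·M_u + ℓδ·3√10·G)) + (6√2·ℓδ·(M_f + G + 2√2·ℓδ·M_u) + M_u + M_q))`
from the sup `M_u` of `u` on `B(x, 4ℓ+1)`, the `η`-gradient bound `G` of `u` on `B(x, 12ℓ+3)`, the sup `M_f` and `½`-Hölder modulus `H_f` of `f`, the sup `M_q` of `q`,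
and the two background rows `‖V − 1‖ ≤ δ` (bondwise) and `‖V(y′) − V(y)‖ ≤ Θ·(tdist y y′∕ℓ)^{1∕2}` on the ball.  With `ℓδ, ℓΘ = O(ε₀)` (the cube axial gauge of a
regular background) the coefficient of `G` on the right is `O(ε₀)·Cg` — the absorption margin of (G1-3b).
[cite: Balaban1985BackgroundPropagators, Lemma 3.2 p.398, (3.45)–(3.48) pp.398–399; Balaban1984PropagatorsII, Lemma 2.1 (2.8)–(2.10) pp.7–8] -/
theorem exists_curved_localGradient : ∃ Cg : ℝ, 0 ≤ Cg ∧
    ∀ (F : T3Family) (n K : ℕ) (c₀ : ℝ) [Fact (0 < c₀)] (V : GaugeField (F.P K) 0 (Matrix.specialUnitaryGroup (Fin 2) ℂ))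
      (u q : SiteL2K ℂ 3 (periodsT3 F K) c₀ W₂) (f : BondL2K ℂ 3 (periodsT3 F K) c₀ W₂) (x : TSite 3 (periodsT3 F K))
      (Mu G Mf Hf Mq δ Θ : ℝ), 0 ≤ Mu → 0 ≤ G → 0 ≤ Mf → 0 ≤ Hf → 0 ≤ Mq → 0 ≤ δ → 0 ≤ Θ →
      covLapSite F n K c₀ V u + q = DstarL2 F n K c₀ V f →
      (∀ y, tdist (periodsT3 F K) x y ≤ 4 * (F.L : ℝ) ^ (K - n) + 1 → ‖WL2.equiv ℂ (fun _ : TSite 3 (periodsT3 F K) => c₀) W₂ u y‖ ≤ Mu) →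
      (∀ (z : TSite 3 (periodsT3 F K)) (μ : Fin 3), tdist (periodsT3 F K) x z ≤ 12 * (F.L : ℝ) ^ (K - n) + 3 →
        (F.L : ℝ) ^ (K - n) * ‖WL2.equiv ℂ (fun _ : TSite 3 (periodsT3 F K) => c₀) W₂ u (shift μ z) - WL2.equiv ℂ (fun _ : TSite 3 (periodsT3 F K) => c₀) W₂ u z‖ ≤ G) →
      (∀ (y : TSite 3 (periodsT3 F K)) (μ : Fin 3), tdist (periodsT3 F K) x y ≤ 4 * (F.L : ℝ) ^ (K - n) + 1 →
        ‖WL2.equiv ℂ (fun _ : Bond 3 (periodsT3 F K) => c₀) W₂ f (y, μ)‖ ≤ Mf) →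
      (∀ (y y' : TSite 3 (periodsT3 F K)) (μ : Fin 3), tdist (periodsT3 F K) x y ≤ 4 * (F.L : ℝ) ^ (K - n) → tdist (periodsT3 F K) x y' ≤ 4 * (F.L : ℝ) ^ (K - n) →
        ‖WL2.equiv ℂ (fun _ : Bond 3 (periodsT3 F K) => c₀) W₂ f (y', μ) - WL2.equiv ℂ (fun _ : Bond 3 (periodsT3 F K) => c₀) W₂ f (y, μ)‖
          ≤ Hf * (tdist (periodsT3 F K) y y' / ((F.L : ℝ) ^ (K - n))) ^ ((1 : ℝ) / 2)) →
      (∀ y, tdist (periodsT3 F K) x y ≤ 4 * (F.L : ℝ) ^ (K - n) → ‖WL2.equiv ℂ (fun _ : TSite 3 (periodsT3 F K) => c₀) W₂ q y‖ ≤ Mq) →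
      (∀ (y : TSite 3 (periodsT3 F K)) (μ : Fin 3), tdist (periodsT3 F K) x y ≤ 4 * (F.L : ℝ) ^ (K - n) + 1 →
        ‖((bgOfCfg F K V (y, μ) : (Matrix (Fin 2) (Fin 2) ℂ)ˣ) : Matrix (Fin 2) (Fin 2) ℂ) - 1‖ ≤ δ) →
      (∀ (y y' : TSite 3 (periodsT3 F K)) (μ : Fin 3), tdist (periodsT3 F K) x y ≤ 4 * (F.L : ℝ) ^ (K - n) → tdist (periodsT3 F K) x y' ≤ 4 * (F.L : ℝ) ^ (K - n) →
        ‖((bgOfCfg F K V (y', μ) : (Matrix (Fin 2) (Fin 2) ℂ)ˣ) : Matrix (Fin 2) (Fin 2) ℂ) - ((bgOfCfg F K V (y, μ) : (Matrix (Fin 2) (Fin 2) ℂ)ˣ) : Matrix (Fin 2) (Fin 2) ℂ)‖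
          ≤ Θ * (tdist (periodsT3 F K) y y' / ((F.L : ℝ) ^ (K - n))) ^ ((1 : ℝ) / 2)) →
      ∀ μ : Fin 3, (F.L : ℝ) ^ (K - n) * ‖WL2.equiv ℂ (fun _ : TSite 3 (periodsT3 F K) => c₀) W₂ u (shift μ x) - WL2.equiv ℂ (fun _ : TSite 3 (periodsT3 F K) => c₀) W₂ u x‖
        ≤ Cg * (Mu + (Hf + 2 * Real.sqrt 2 * (((F.L : ℝ) ^ (K - n) * Θ) * Mu + ((F.L : ℝ) ^ (K - n) * δ) * (3 * Real.sqrt 10 * G)))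
          + (6 * Real.sqrt 2 * ((F.L : ℝ) ^ (K - n) * δ) * (Mf + G + 2 * Real.sqrt 2 * ((F.L : ℝ) ^ (K - n) * δ) * Mu) + Mu + Mq)) := by
  obtain ⟨Cg, hCg0, hD⟩ := exists_localGradient_flat_member_sourced
  refine ⟨Cg, hCg0, ?_⟩
  intro F n K c₀ _ V u q f x Mu G Mf Hf Mq δ Θ hMu0 hG0 hMf0 hHf0 hMq0 hδ0 hΘ0 h hMu hG hMf hHf hMq hδ hΘ
  exact curved_localGradient_of_flatSourced F n K c₀ V u q f x hMu0 hG0 hMf0 hHf0 hMq0 hδ0 hΘ0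
    (fun g r Mu' Hf' Mr' h1 h2 h3 he hbu hbg hbr => hD F n K c₀ u r g x Mu' Hf' Mr' h1 h2 h3 he hbu hbg hbr) h hMu hG hMf hHf hMq hδ hΘ

end Summit.QuantumFields.YangMills.Theorems.Prop7CurvedMemberLocalGradient

end
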